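import Literature.NumberTheory.QuadraticFields.KroneckerCharacterFourProofs
import Literature.NumberTheory.QuadraticFields.KroneckerSplitting
import Literature.NumberTheory.EllipticCurves.KrizLi2019.EisensteinHeegnerLog
import Mathlib.NumberTheory.LegendreSymbol.JacobiSymbol
import HarnessLib

/-!
# ROUTE U, EVEN members — the Kronecker character of an EVEN discriminant `4m` as a `ℚ₇`-valued
# Dirichlet character mod `4|m|`: existence, primitivity, parity, `IsKroneckerCharacterOf`

bsd-cm cell (run/shared/lean/pub/bsd-cm/), ROUTE U (Theorem U: BSD(49a1^{(D)}, 7)), seat `bsd-cm-ram`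
(g6). The even members `D = −4n` of the O11 class at `7` (`−4, −8, −20, −24, −40, −52, −68, −88`)
twist `49a1` by the imaginary quadratic field `M = ℚ(√−n)` of EVEN discriminant `d_M = −4n`
(`n ≡ 1, 2 (mod 4)` squarefree); the twin `49a1^{(4nr)}` is the twist by the REAL field `ℚ(√(nr))`
of discriminant `4nr`. Kriz–Li Thm 1.20, Buhler–Gross 1985 Ch. II and Rubin 1983 Thm C (named
facts) consume the Kronecker characters of these fields as `ℚ₇`-valued Dirichlet characters
`ε` mod `|d|` with `IsKroneckerCharacterOf`. The tree's `Literature/.../KroneckerCharacterFourProofs`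
does all of this for `ℂ`-valued characters; this file is its `ℚ₇`-valued port (same proofs, the
Jacobi-symbol lemmas of that file reused by name); the reciprocity forms of the values used by the
member certificates are in `RouteUKroneckerReciprocity`:

* `exists_kroneckerFour` — a character `χ` mod `k = 4|m|` with `χ(a) = [a odd]·J(m | a)` for ALL
  `a : ℕ` (the level is any `k` with a proof `k = 4|m|`, so that `k = 4n` serves `m = −n`);
* `isPrimitive_kroneckerFour` — primitive (conductor `4|m|`) for `m ≡ 2, 3 (mod 4)` squarefree;
* `kroneckerFour_odd` (`m < 0`) / `kroneckerFour_even` (`m > 0`) — parity;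
* `isKroneckerCharacterOf_kroneckerFour` — for a quadratic field `M` with `d_M = 4m`, the lift of
  such a (primitive) `χ` to level `|d_M|` IS the Kronecker character of `M`
  (`KrizLi2019.IsKroneckerCharacterOf`).

THEOREMS ONLY; no definitions, no named facts; nothing booked. References: [Cox2013] §1.C
Lemma 1.14, (1.15)–(1.18); [MontgomeryVaughan2007] Thm. 9.13; [KrizLi2019] §2 (p. 12, ε_K).
-/

noncomputable section

open scoped Classical NumberTheorySymbols
open NumberField
open Literature.NumberTheory.QuadraticFields Literature.NumberTheory.EllipticCurves.KrizLi2019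

namespace Summit.BirchSwinnertonDyer.Rank1Residual.X12.O11.RouteU

/-! ## §1 Existence: `a ↦ (m / a)` as a `ℚ₇`-valued character mod `4|m|` -/

/-- **The Kronecker symbol `a ↦ (m / a)` as a `ℚ₇`-valued Dirichlet character mod `4|m|`**
(`m ≠ 0`): there is a Dirichlet character `χ` modulo `4|m|` with `χ(a) = (m / a)` for odd `a` and
`χ(a) = 0` for even `a`, i.e. `χ(a) = [a odd]·J(m | a)` for every `a : ℕ`. Well defined because
`(m / a)` depends only on `a mod 4|m|` for odd `a` (Mathlib `jacobiSym.mod_right`).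
-- adapted from Literature/NumberTheory/QuadraticFields/KroneckerCharacterFourProofs.lean
-- (`exists_dirichletCharacter_four_mul`, ℂ-valued), values in `ℚ₇` and at all `a`.
[cite: Cox2013, §1.C Lemma 1.14] -/
theorem exists_kroneckerFour (m : ℤ) (hm0 : m ≠ 0) {k : ℕ} (hk : k = 4 * m.natAbs) :
    ∃ χ : DirichletCharacter ℚ_[7] k,
      ∀ a : ℕ, χ (a : ZMod k) = ((if Even a then (0 : ℤ) else J(m | a) : ℤ) : ℚ_[7]) := by
  subst hk
  set q : ℕ := 4 * m.natAbs with hq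
  have hq0 : q ≠ 0 := mul_ne_zero (by norm_num) (Int.natAbs_ne_zero.mpr hm0)
  haveI : NeZero q := ⟨hq0⟩
  have hq2 : 2 ∣ q := ⟨2 * m.natAbs, by rw [hq]; ring⟩
  -- parity of `x % q` is that of `x`
  have hpar : ∀ x : ℕ, Even (x % q) ↔ Even x := fun x ↦ by
    have h2x : Even (q * (x / q)) := (even_iff_two_dvd.mpr hq2).mul_right _
    refine ⟨fun h ↦ ?_, fun h ↦ ?_⟩
    · rw [← Nat.mod_add_div x q]; exact h.add h2x
    · have h' : Even (x % q + q * (x / q)) := by rwa [Nat.mod_add_div]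
      exact (Nat.even_add.mp h').mpr h2x
  -- the values
  set f : ZMod q → ℚ_[7] := fun a ↦ if Even a.val then 0 else (J(m | a.val) : ℚ_[7]) with hf
  have hf_odd : ∀ a : ℕ, Odd a → f a = (J(m | a) : ℚ_[7]) := fun a ha ↦ by
    have hodd : ¬ Even ((a : ZMod q).val) := by
      rw [ZMod.val_natCast, hpar]; exact Nat.not_even_iff_odd.mpr ha
    simp only [hf, if_neg hodd]
    rw [ZMod.val_natCast, ← jacobiSym.mod_right m ha]
  have hf_even : ∀ a : ZMod q, Even a.val → f a = 0 := fun a ha ↦ by simp only [hf, if_pos ha]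
  refine ⟨{ toFun := f, map_one' := ?_, map_mul' := ?_, map_nonunit' := ?_ }, ?_⟩
  · have h1 := hf_odd 1 odd_one
    rw [jacobiSym.one_right, Int.cast_one] at h1
    simpa using h1
  · intro a b
    have hab : (a * b).val = (a.val * b.val) % q := ZMod.val_mul a b
    by_cases ha : Even a.val
    · have h : Even (a * b).val := by rw [hab, hpar, Nat.even_mul]; exact Or.inl ha
      rw [hf_even _ h, hf_even _ ha, zero_mul]
    · by_cases hb : Even b.val
      · have h : Even (a * b).val := by rw [hab, hpar, Nat.even_mul]; exact Or.inr hb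
        rw [hf_even _ h, hf_even _ hb, mul_zero]
      · have ha' := Nat.not_even_iff_odd.mp ha
        have hb' := Nat.not_even_iff_odd.mp hb
        have hab' : ¬ Even (a * b).val := by
          rw [hab, hpar, Nat.even_mul, not_or]
          exact ⟨ha, hb⟩
        calc f (a * b) = (J(m | (a * b).val) : ℚ_[7]) := by simp only [hf, if_neg hab']
          _ = (J(m | a.val * b.val) : ℚ_[7]) := by rw [hab, ← jacobiSym.mod_right m (ha'.mul hb')]
          _ = (J(m | a.val) : ℚ_[7]) * (J(m | b.val) : ℚ_[7]) := by
            rw [jacobiSym.mul_right' m ha'.pos.ne' hb'.pos.ne', Int.cast_mul]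
          _ = f a * f b := by simp only [hf, if_neg ha, if_neg hb]
  · intro a ha
    by_cases hev : Even a.val
    · exact hf_even a hev
    · have hodd := Nat.not_even_iff_odd.mp hev
      rw [← ZMod.natCast_zmod_val a, hf_odd _ hodd, Int.cast_eq_zero]
      have hval : ¬ a.val.Coprime q := fun h ↦ ha (by
        rw [← ZMod.natCast_zmod_val a]
        exact (ZMod.isUnit_iff_coprime a.val q).mpr h)
      haveI : NeZero a.val := ⟨hodd.pos.ne'⟩
      rw [jacobiSym.eq_zero_iff_not_coprime, Int.gcd_comm, Int.gcd_eq_natAbs, Int.natAbs_natCast]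
      intro hcop
      apply hval
      change a.val.Coprime (4 * m.natAbs)
      refine Nat.Coprime.mul_right ?_ hcop
      exact Nat.Coprime.pow_right 2 (Nat.coprime_two_right.mpr hodd)
  · intro a
    by_cases ha : Even a
    · rw [if_pos ha, Int.cast_zero]
      have hev : Even ((a : ZMod q).val) := by rw [ZMod.val_natCast, hpar]; exact ha
      exact hf_even _ hev
    · rw [if_neg ha]
      exact hf_odd a (Nat.not_even_iff_odd.mp ha)

/-! ## §2 Primitivity -/

section Properties

variable {m : ℤ} {k : ℕ} {χ : DirichletCharacter ℚ_[7] k}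

/-- **The `ℚ₇`-valued character mod `4|m|` with values `(m / a)` at odd `a` is primitive** for
`m ≡ 2, 3 (mod 4)` squarefree (conductor `4|m| = |4m|`, the Kronecker character of the even
fundamental discriminant `4m`). Same proof as the `ℂ`-valued tree theorem: a factorisation through
a proper divisor of the level is refuted by a unit `u ≡ 1 (mod c)` with `χ(u) = −1`.
-- adapted from Literature/NumberTheory/QuadraticFields/KroneckerCharacterFourProofs.lean
-- (`isPrimitive_of_forall_odd`, ℂ-valued).
[cite: MontgomeryVaughan2007, Theorem 9.13] [cite: Cox2013, §1.C Lemma 1.14] -/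
theorem isPrimitive_kroneckerFour (hk : k = 4 * m.natAbs) (hm4 : m % 4 = 2 ∨ m % 4 = 3)
    (hsq : Squarefree m) (hχ : ∀ a : ℕ, Odd a → χ a = (J(m | a) : ℚ_[7])) : χ.IsPrimitive := by
  subst hk
  have hm0 : m ≠ 0 := hsq.ne_zero
  have hn0 : 0 < m.natAbs := Int.natAbs_pos.mpr hm0
  have hsqn : Squarefree m.natAbs := Int.squarefree_natAbs.mpr hsq
  haveI : NeZero (4 * m.natAbs) := ⟨by omega⟩
  rw [DirichletCharacter.isPrimitive_def]
  have hcdvd : χ.conductor ∣ 4 * m.natAbs := DirichletCharacter.conductor_dvd_level χ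
  have hft : χ.FactorsThrough χ.conductor := DirichletCharacter.factorsThrough_conductor χ
  by_contra hne
  -- it suffices to find a unit `u ≡ 1 (mod c)` with `χ u = -1`
  suffices key : ∃ u : ℕ, u.Coprime (4 * m.natAbs) ∧ (u : ZMod χ.conductor) = 1 ∧ χ u = -1 by
    obtain ⟨u, hu, hu1, hχu⟩ := key
    have hker := (DirichletCharacter.factorsThrough_iff_ker_unitsMap hcdvd).mp hft
    have hx : ZMod.unitOfCoprime u hu ∈ (ZMod.unitsMap hcdvd).ker := by
      rw [MonoidHom.mem_ker, ZMod.unitsMap_def, Units.ext_iff, Units.coe_map, MonoidHom.coe_coe,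
        ZMod.castHom_apply, Units.val_one, ZMod.coe_unitOfCoprime, ZMod.cast_natCast hcdvd]
      exact hu1
    have h1 := hker hx
    rw [MonoidHom.mem_ker, Units.ext_iff, MulChar.coe_toUnitHom, Units.val_one,
      ZMod.coe_unitOfCoprime, hχu] at h1
    norm_num at h1
  -- a prime `ℓ` dividing `4|m| / c`
  obtain ⟨k, hk⟩ := hcdvd
  have hk1 : k ≠ 1 := fun h ↦ hne (by rw [h, mul_one] at hk; exact hk.symm)
  obtain ⟨ℓ, hℓ, hℓk⟩ := Nat.exists_prime_and_dvd hk1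
  -- the sign of `m` does not matter at `u ≡ 1 (mod 4)`
  have hsign : ∀ {u : ℕ}, Odd u → u % 4 = 1 → J(m | u) = J((m.natAbs : ℤ) | u) := fun hu hu4 ↦ by
    rw [jacobiSym_eq_sign_mul_natAbs m hu]
    split_ifs
    · rw [ZMod.χ₄_nat_one_mod_four hu4, one_mul]
    · rw [one_mul]
  have hcop4 : ∀ {u : ℕ}, Odd u → u.Coprime 4 := fun hu ↦ by
    simpa using Nat.Coprime.pow_right 2 (Nat.coprime_two_right.mpr hu)
  by_cases hℓ2 : ℓ = 2
  · /- `ℓ = 2`: `c ∣ 2|m|`; take `u = 1 + 2|m|` -/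
    subst hℓ2
    obtain ⟨k', hk'⟩ := hℓk
    have hc2n : χ.conductor ∣ 2 * m.natAbs := ⟨k', by
      have h4 : 4 * m.natAbs = 2 * (χ.conductor * k') :=
        calc 4 * m.natAbs = χ.conductor * k := hk
          _ = 2 * (χ.conductor * k') := by rw [hk']; ring
      omega⟩
    have huodd : Odd (1 + 2 * m.natAbs) := ⟨m.natAbs, by ring⟩
    refine ⟨1 + 2 * m.natAbs, ?_, ?_, ?_⟩
    · refine Nat.Coprime.mul_right (hcop4 huodd) ?_
      have h := (Nat.coprime_add_mul_left_left 1 m.natAbs 2).mpr (Nat.coprime_one_left _)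
      rwa [mul_comm] at h
    · rw [Nat.cast_add, Nat.cast_one, (ZMod.natCast_eq_zero_iff (2 * m.natAbs) χ.conductor).mpr hc2n,
        add_zero]
    · rw [hχ _ huodd]
      suffices h : J(m | 1 + 2 * m.natAbs) = -1 by rw [h]; norm_num
      rcases hm4 with h4 | h4
      · -- `m ≡ 2 (mod 4)`: `|m| = 2n₀`, `n₀` odd, `u = 4n₀ + 1 ≡ 5 (mod 8)`
        obtain ⟨n₀, hn₀⟩ : 2 ∣ m.natAbs := by omega
        have hn₀2 : n₀ % 2 = 1 := by omega
        have hn₀odd : Odd n₀ := Nat.odd_iff.mpr hn₀2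
        have hu4 : (1 + 2 * m.natAbs) % 4 = 1 := by omega
        rw [hsign huodd hu4, show (m.natAbs : ℤ) = 2 * (n₀ : ℤ) by rw [hn₀]; push_cast; ring,
          jacobiSym.mul_left, jacobiSym.at_two huodd,
          (χ₈_nat_of_mod_eight (b := 1 + 2 * m.natAbs)).2 (by omega),
          jacobiSym_eq_one_of_mod_four_eq_one_of_emod_eq_one hn₀odd hu4 ?_]
        · norm_num
        · rw [hn₀]
          push_cast
          rw [show (1 : ℤ) + 2 * (2 * (n₀ : ℤ)) = 1 + (n₀ : ℤ) * 4 by ring, Int.add_mul_emod_self_left]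
      · -- `m ≡ 3 (mod 4)`: `|m|` odd, `u = 2|m| + 1 ≡ 3 (mod 4)`
        have hnodd : Odd m.natAbs := Nat.odd_iff.mpr (by omega)
        have hu4 : (1 + 2 * m.natAbs) % 4 = 3 := by omega
        have hJn : J((m.natAbs : ℤ) | 1 + 2 * m.natAbs) = ZMod.χ₄ m.natAbs :=
          jacobiSym_eq_χ₄_of_mod_four_eq_three_of_emod_eq_one hnodd hu4 (by
            push_cast
            rw [show (1 : ℤ) + 2 * |m| = 1 + |m| * 2 by ring, Int.add_mul_emod_self_left])
        rw [jacobiSym_eq_sign_mul_natAbs m huodd, hJn]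
        split_ifs with hneg
        · rw [ZMod.χ₄_nat_three_mod_four hu4, ZMod.χ₄_nat_one_mod_four (by omega)]
          norm_num
        · rw [one_mul, ZMod.χ₄_nat_three_mod_four (by omega)]
  · /- `ℓ` odd: `ℓ ∣ |m|`, `c ∣ 4|m|/ℓ = 4n'`; take `u ≡ 1 (mod 4n')`, `u` a non-residue mod `ℓ` -/
    haveI := Fact.mk hℓ
    have hℓodd : Odd ℓ := hℓ.odd_of_ne_two hℓ2
    have hℓq : ℓ ∣ 4 * m.natAbs := hk ▸ hℓk.mul_left χ.conductor
    have hℓn : ℓ ∣ m.natAbs := (hcop4 hℓodd).dvd_of_dvd_mul_left hℓq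
    obtain ⟨n', hn'⟩ := hℓn
    have hn'0 : 0 < n' := Nat.pos_of_ne_zero fun h ↦ by rw [h, mul_zero] at hn'; omega
    have hℓn' : ¬ ℓ ∣ n' := fun h ↦ by
      have : ℓ * ℓ ∣ m.natAbs := hn' ▸ mul_dvd_mul_left ℓ h
      exact hℓ.one_lt.ne' (Nat.isUnit_iff.mp (hsqn ℓ this))
    -- `c ∣ 4 n'`
    have hc4n' : χ.conductor ∣ 4 * n' := by
      obtain ⟨k', hk'⟩ := hℓk
      refine ⟨k', Nat.eq_of_mul_eq_mul_left hℓ.pos ?_⟩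
      calc ℓ * (4 * n') = 4 * m.natAbs := by rw [hn']; ring
        _ = χ.conductor * k := hk
        _ = ℓ * (χ.conductor * k') := by rw [hk']; ring
    -- a non-residue `a` mod `ℓ` and `u ≡ a (mod ℓ)`, `u ≡ 1 (mod 4n')`
    have hcop : ℓ.Coprime (4 * n') :=
      Nat.Coprime.mul_right (hcop4 hℓodd) ((Nat.Prime.coprime_iff_not_dvd hℓ).mpr hℓn')
    have hchar : ringChar (ZMod ℓ) ≠ 2 := by rwa [ZMod.ringChar_zmod_n]
    obtain ⟨a, ha⟩ := quadraticChar_exists_neg_one hchar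
    have ha0 : a ≠ 0 := by
      rintro rfl
      rw [MulChar.map_zero] at ha; norm_num at ha
    obtain ⟨u, hu1, hu2⟩ := Nat.chineseRemainder hcop a.val 1
    have huℓ : u % ℓ = a.val := by
      rw [show u % ℓ = a.val % ℓ from hu1, Nat.mod_eq_of_lt (ZMod.val_lt a)]
    have hu4n' : u % (4 * n') = 1 := by
      rw [show u % (4 * n') = 1 % (4 * n') from hu2, Nat.mod_eq_of_lt (by omega)]
    have hu4 : u % 4 = 1 := by
      have := Nat.mod_mod_of_dvd u (dvd_mul_right 4 n')
      rw [hu4n'] at this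
      omega
    have huodd : Odd u := Nat.odd_iff.mpr (by omega)
    refine ⟨u, ?_, ?_, ?_⟩
    · -- `u` is a unit mod `4|m| = ℓ · 4n'`
      have huℓ' : u.Coprime ℓ := by
        refine ((Nat.Prime.coprime_iff_not_dvd hℓ).mpr fun h ↦ ha0 ?_).symm
        rw [← ZMod.val_eq_zero, ← huℓ]
        exact Nat.mod_eq_zero_of_dvd h
      have hur : u.Coprime (4 * n') := by
        have h := Nat.ModEq.gcd_eq (hu2 : u ≡ 1 [MOD 4 * n'])
        rwa [Nat.gcd_one_left] at h
      rw [show 4 * m.natAbs = ℓ * (4 * n') by rw [hn']; ring]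
      exact Nat.Coprime.mul_right huℓ' hur
    · have h := (ZMod.natCast_eq_natCast_iff u 1 χ.conductor).mpr (Nat.ModEq.of_dvd hc4n' hu2)
      rwa [Nat.cast_one] at h
    · rw [hχ _ huodd, hsign huodd hu4, hn', Nat.cast_mul, jacobiSym.mul_left,
        jacobiSym.quadratic_reciprocity_one_mod_four' hℓodd hu4,
        jacobiSym_natCast_eq_one_of_mod_four_mul huodd hu4n', mul_one, ← jacobiSym_natCast_mod,
        huℓ, ← jacobiSym.legendreSym.to_jacobiSym, legendreSym, Int.cast_natCast, ZMod.natCast_zmod_val,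
        ha]
      norm_num

/-! ## §3 Parity -/

/-- **`χ(−1) = −1` for `m < 0`** (`m ≡ 2, 3 (mod 4)`): the Kronecker character of an imaginary
quadratic field of even discriminant `4m` is ODD. Computation: `χ(−1) = (m / 4|m|−1)
= (−1 / 4|m|−1)·(|m| / 4|m|−1) = −1·1` (reciprocity).
-- adapted from Literature/NumberTheory/QuadraticFields/KroneckerCharacterFourProofs.lean
-- (`apply_neg_one_of_forall_odd`, ℂ-valued).
[cite: Cox2013, §1.C Lemma 1.14] -/
theorem kroneckerFour_odd (hk : k = 4 * m.natAbs) (hm : m < 0) (hm4 : m % 4 = 2 ∨ m % 4 = 3)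
    (hχ : ∀ a : ℕ, Odd a → χ a = (J(m | a) : ℚ_[7])) : χ.Odd := by
  subst hk
  rw [DirichletCharacter.Odd]
  set n := m.natAbs with hn
  have hmn : m = -(n : ℤ) := by omega
  have hn0 : 0 < n := by omega
  haveI : NeZero (4 * n) := ⟨by omega⟩
  have hcast : ((4 * n - 1 : ℕ) : ZMod (4 * n)) = -1 := by
    rw [Nat.cast_sub (by omega), Nat.cast_one, ZMod.natCast_self, zero_sub]
  have hodd : Odd (4 * n - 1) := Nat.odd_iff.mpr (by omega)
  have hb4 : (4 * n - 1) % 4 = 3 := by omega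
  rw [← hcast, hχ _ hodd, hmn, jacobiSym.neg _ hodd, ZMod.χ₄_nat_three_mod_four hb4]
  -- `J(n | 4n - 1) = 1`
  suffices h : J((n : ℤ) | 4 * n - 1) = 1 by rw [h]; norm_num
  rcases hm4 with h4 | h4
  · -- `m ≡ 2 (mod 4)`: `n = 2 n₀` with `n₀` odd
    obtain ⟨n₀, hn₀⟩ : 2 ∣ n := by omega
    have hn₀2 : n₀ % 2 = 1 := by omega
    have hn₀odd : Odd n₀ := Nat.odd_iff.mpr hn₀2
    rw [show (n : ℤ) = 2 * (n₀ : ℤ) by rw [hn₀]; push_cast; ring, jacobiSym.mul_left,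
      jacobiSym.at_two hodd, (χ₈_nat_of_mod_eight (b := 4 * n - 1)).1 (by omega), one_mul]
    refine jacobiSym_eq_one_of_mod_four_eq_three_of_emod_eq_neg_one hn₀odd hb4 ?_
    rw [Nat.cast_sub (by omega)]
    push_cast
    rw [show (4 : ℤ) * (n : ℤ) - 1 = -1 + (n₀ : ℤ) * 8 by rw [hn₀]; push_cast; ring,
      Int.add_mul_emod_self_left]
  · -- `m ≡ 3 (mod 4)`: `n` odd
    have hnodd : Odd n := Nat.odd_iff.mpr (by omega)
    refine jacobiSym_eq_one_of_mod_four_eq_three_of_emod_eq_neg_one hnodd hb4 ?_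
    rw [Nat.cast_sub (by omega)]
    push_cast
    rw [show (4 : ℤ) * (n : ℤ) - 1 = -1 + (n : ℤ) * 4 by ring, Int.add_mul_emod_self_left]

/-- **`χ(−1) = 1` for `m > 0`** (`m ≡ 2, 3 (mod 4)`): the Kronecker character of a REAL quadratic
field of even discriminant `4m` is EVEN. Computation: `χ(−1) = (m / 4m−1) = 1` (for `m` odd,
`4m − 1 ≡ 3 (mod 4)` and `≡ −1 (mod m)`: reciprocity; for `m = 2n₀`:
`(2 / 8n₀−1)(n₀ / 8n₀−1) = 1·1`). [cite: Cox2013, §1.C Lemma 1.14] -/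
theorem kroneckerFour_even (hk : k = 4 * m.natAbs) (hm : 0 < m) (hm4 : m % 4 = 2 ∨ m % 4 = 3)
    (hχ : ∀ a : ℕ, Odd a → χ a = (J(m | a) : ℚ_[7])) : χ.Even := by
  subst hk
  rw [DirichletCharacter.Even]
  set n := m.natAbs with hn
  have hmn : m = (n : ℤ) := by omega
  have hn0 : 0 < n := by omega
  haveI : NeZero (4 * n) := ⟨by omega⟩
  have hcast : ((4 * n - 1 : ℕ) : ZMod (4 * n)) = -1 := by
    rw [Nat.cast_sub (by omega), Nat.cast_one, ZMod.natCast_self, zero_sub]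
  have hodd : Odd (4 * n - 1) := Nat.odd_iff.mpr (by omega)
  have hb4 : (4 * n - 1) % 4 = 3 := by omega
  rw [← hcast, hχ _ hodd, hmn]
  suffices h : J((n : ℤ) | 4 * n - 1) = 1 by rw [h, Int.cast_one]
  rcases hm4 with h4 | h4
  · -- `m ≡ 2 (mod 4)`: `n = 2 n₀` with `n₀` odd
    obtain ⟨n₀, hn₀⟩ : 2 ∣ n := by omega
    have hn₀2 : n₀ % 2 = 1 := by omega
    have hn₀odd : Odd n₀ := Nat.odd_iff.mpr hn₀2
    rw [show (n : ℤ) = 2 * (n₀ : ℤ) by rw [hn₀]; push_cast; ring, jacobiSym.mul_left,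
      jacobiSym.at_two hodd, (χ₈_nat_of_mod_eight (b := 4 * n - 1)).1 (by omega), one_mul]
    refine jacobiSym_eq_one_of_mod_four_eq_three_of_emod_eq_neg_one hn₀odd hb4 ?_
    rw [Nat.cast_sub (by omega)]
    push_cast
    rw [show (4 : ℤ) * (n : ℤ) - 1 = -1 + (n₀ : ℤ) * 8 by rw [hn₀]; push_cast; ring,
      Int.add_mul_emod_self_left]
  · -- `m ≡ 3 (mod 4)`: `n` odd
    have hnodd : Odd n := Nat.odd_iff.mpr (by omega)
    refine jacobiSym_eq_one_of_mod_four_eq_three_of_emod_eq_neg_one hnodd hb4 ?_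
    rw [Nat.cast_sub (by omega)]
    push_cast
    rw [show (4 : ℤ) * (n : ℤ) - 1 = -1 + (n : ℤ) * 4 by ring, Int.add_mul_emod_self_left]

end Properties

/-! ## §4 The Kronecker character of a quadratic field of even discriminant -/

/-- **`IsKroneckerCharacterOf` for an even discriminant.** Let `M` be a quadratic field with
`d_M = 4m`, and `χ` a PRIMITIVE `ℚ₇`-valued character of level `k = 4|m|` with `χ(a) = (m / a)`
at odd `a`. Then the lift of `χ` along `k ∣ |d_M|` (in fact `k = |d_M|`) is the Kronecker character
of `M` in the sense of `KrizLi2019.IsKroneckerCharacterOf`: primitive, and at every prime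
`ℓ ∤ d_M` (necessarily odd) `χ(ℓ) = (m/ℓ) = (4m/ℓ) = 1` iff `ℓ` splits in `M`
(`Quadratic.ncard_primesOver_eq_two_iff_legendreSym`).
[cite: KrizLi2019, §2 (p. 12, "ε_K the quadratic character associated with K")]
[cite: Cox2013, §1.C Lemma 1.14 and (1.18)] -/
theorem isKroneckerCharacterOf_kroneckerFour {M : Type} [Field M] [NumberField M]
    (hM2 : Module.finrank ℚ M = 2) {m : ℤ} (hdM : NumberField.discr M = 4 * m)
    {k : ℕ} [NeZero k] (χ : DirichletCharacter ℚ_[7] k) (hχp : χ.IsPrimitive)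
    (hχ : ∀ a : ℕ, Odd a → χ a = (J(m | a) : ℚ_[7])) (hk : k = 4 * m.natAbs)
    (h : k ∣ (NumberField.discr M).natAbs) :
    IsKroneckerCharacterOf M (DirichletCharacter.changeLevel h χ) := by
  have hnat : (NumberField.discr M).natAbs = k := by rw [hdM, hk, Int.natAbs_mul]; rfl
  refine ⟨?_, fun ℓ hℓ hnd => ?_⟩
  · rw [DirichletCharacter.isPrimitive_def, DirichletCharacter.conductor_changeLevel, hχp, hnat]
  · haveI := Fact.mk hℓ
    have hℓ2 : ℓ ≠ 2 := by rintro rfl; exact hnd (by rw [hdM]; exact Dvd.dvd.mul_right (by norm_num) m)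
    have hodd : Odd ℓ := hℓ.odd_of_ne_two hℓ2
    have hcop : IsCoprime (ℓ : ℤ) ((NumberField.discr M).natAbs : ℕ) := by
      rw [Int.isCoprime_iff_gcd_eq_one, Int.gcd_natCast_natCast, ← Nat.coprime_iff_gcd_eq_one,
        Nat.Prime.coprime_iff_not_dvd hℓ]
      intro hdvd; apply hnd
      exact Int.dvd_natAbs.mp (by exact_mod_cast hdvd)
    have hval : DirichletCharacter.changeLevel h χ (ℓ : ZMod (NumberField.discr M).natAbs) =
        χ (ℓ : ZMod k) := by
      have := DirichletCharacter.changeLevel_eq_cast_of_dvd' χ h hcop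
      simpa [Int.cast_natCast] using this
    rw [hval, hχ ℓ hodd, ← jacobiSym.legendreSym.to_jacobiSym]
    -- `(d_M / ℓ) = (4m / ℓ) = (m / ℓ)`
    have hℓm : ¬ ((ℓ : ℤ) ∣ m) := fun hd => hnd (by rw [hdM]; exact hd.mul_left 4)
    have hm0 : ((m : ℤ) : ZMod ℓ) ≠ 0 := by rwa [Ne, ZMod.intCast_zmod_eq_zero_iff_dvd]
    have h20 : ((2 : ℤ) : ZMod ℓ) ≠ 0 := by
      rw [Ne, ZMod.intCast_zmod_eq_zero_iff_dvd]
      intro hd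
      exact hℓ2 ((Nat.prime_dvd_prime_iff_eq hℓ Nat.prime_two).mp (by exact_mod_cast hd))
    have hleg : legendreSym ℓ (NumberField.discr M) = legendreSym ℓ m := by
      rw [hdM, legendreSym.mul, show (4 : ℤ) = 2 ^ 2 by norm_num, legendreSym.sq_one' ℓ h20, one_mul]
    rcases legendreSym.eq_one_or_neg_one ℓ hm0 with h1 | h1
    · rw [h1, if_pos ((Quadratic.ncard_primesOver_eq_two_iff_legendreSym hM2 hℓ2).mpr (by rw [hleg, h1])),
        Int.cast_one]
    · have hs : ((Ideal.span {(ℓ : ℤ)}).primesOver (𝓞 M)).ncard ≠ 2 := fun hs => by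
        have := (Quadratic.ncard_primesOver_eq_two_iff_legendreSym hM2 hℓ2).mp hs
        rw [hleg, h1] at this; norm_num at this
      rw [h1, if_neg hs, Int.cast_neg, Int.cast_one]

end Summit.BirchSwinnertonDyer.Rank1Residual.X12.O11.RouteU

end
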